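import Summits.HodgeConjecture.HodgeCM.PerL34.ThetaSubOfLiu_1

/-! PORT of `HodgeCM/PerL34/ThetaSubOfLiu.lean` (HodgeCMPerL run 82) — part 2: continuation of `Summits.HodgeConjecture.HodgeCM.PerL34.ThetaSubOfLiu_1` (split at a top-level declaration boundary by port_pkg.py; scope re-opened below; declarations unchanged). -/

-- port_pkg: scope re-opened for this part (file-level context, then the namespace/section stack open at the cut)
noncomputable section
open scoped TensorProduct
namespace HodgeCM
open Literature.AlgebraicGeometry.Motives (CMType)
open NumberField
open CMTypeOps (inflate)
namespace Universe
variable (U : Universe)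
variable {U}
namespace ThetaModel
variable (T : U.ThetaModel)
/-- **PRINT-INTERFACE — [Liu21] Prop 4.13 + Thm 4.18 (with its proof) read in the model; standing as `Fact_embCover` /
`Fact_innerEmb`: a published theorem + a labelled dictionary, NOT a kernel theorem and NOT an internally-minted claim.**
In a good seesaw context, for each type index `i` and level `Γ`, there are a CM field `M`, an embedding `k : K →+* M`
and `σ' : M →+* ℂ` with `σ' ∘ k = σ`, such that every theta one-form of type `Ψᵢ` at level `Γ` is a finite sum of
pullbacks `F^*α` of holomorphic `σ'`-eigen one-forms of the CM abelian variety `A_{(M, Ψᵢ^M)}` of the INFLATED type.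

PRINT (Yifeng Liu, *Fourier–Jacobi cycles and arithmetic relative trace formula*, Camb. J. Math. 9 (2021) no. 1, 1–147 =
arXiv:2102.11518 [Liu21]; held TeX, [corpus:paper:arxiv-2102.11518]).  Setting §4.2 (p0020 L1–27): `E/F` CM, `𝕍` totally
positive definite incoherent hermitian space of rank `n`, `X_K` the (compactified; = itself in the Compact Case) unitary
Shimura variety of level `K` (sufficiently small), `A_K := Alb(X_K)`, `A_∞ = lim A_K`,
`H¹_{B,τ'}(A_∞,ℂ) := colim_K H¹_{B,τ'}(A_K,ℂ)`.  PROP 4.13 (p0020 L53–58): "Suppose that `n ≥ 3`. Then for every embedding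
`τ' : E → ℂ`, there is an isomorphism `H¹_{B,τ'}(A_∞,ℂ) ≅ ⊕_{(μ,ε,χ)} ω(μ,ε,χ)` of `ℂ[U(𝕍)(𝔸_F^∞)]`-modules, where the direct
sum is taken over all adèlic oscillator triples in which `μ` is of weight one and `ε` is `μ`-admissible."; its proof
begins (p0020 L60–63) "By Lemma (le:albanese), we have a canonical isomorphism `H¹_{B,τ'}(A_∞,ℂ) ≅ H¹_{B,τ'}(X_∞,ℂ) =
colim_K H¹_{B,τ'}(X_K,ℂ)`".  DEF 4.16 / REMARK 4.17 (p0022 L50–57): `Ω(μ) := colim_{D_μ} Hom_E(A_∞,A_μ)_ℚ ≅ Hom_E(A_∞,A_μ)_ℚ`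
as `M_μ[U(𝕍)(𝔸_F^∞)]`-module, `M_μ` acting via `i_μ`.  THM 4.18 (p0022 L59–70): "There is an isomorphism
`Ω(μ) ⊗_{M_μ} ℂ ≅ ⊕_ε ⊕_χ ω(μ,ε,χ)` of `ℂ[U(𝕍)(𝔸_F^∞)]`-modules, where the direct sum is taken over all `ε, χ` such that `ε`
is `μ`-admissible. Moreover, (1) For every object `D_μ = (A_μ,i_μ,λ_μ,r_μ) ∈ 𝒟(μ)`, we have a canonical isomorphism
`Ω(μ)^K ≅ Hom_E(A_K,A_μ)_ℚ` for every sufficiently small open compact subgroup `K ⊆ U(𝕍)(𝔸_F^∞)`. (2) … mutually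
non-isomorphic. (3) …"; PROOF (p0022 L72–p0023 L14): "Take an embedding `τ' : E → ℂ` in `Φ_μ`. It is clear that the maximal
subspace of the complex vector space `H¹_{B,τ'}(A_μ,ℂ)` over which `M_μ` acts via the inclusion `M_μ ⊂ ℂ` has dimension 1.
We choose a basis `α` of this subspace. Then we obtain a map `Ω(μ) → H¹_{B,τ'}(A_∞,ℂ)` by pulling back `α` … we obtain an
isomorphism as in the theorem, which depends only on `α` … induced by pulling back `α`".  So: the `ω(μ,ε,χ)`-isotypic
part of `H¹_{B,τ'}(A_K,ℂ) = H¹_{B,τ'}(X_K,ℂ)` is `{Σ_ℓ c_ℓ f_ℓ^*α ∣ f_ℓ ∈ Hom_E(A_K,A_μ)}` (multiplicity one, Prop 4.13).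
CM DATA, DEF 4.3 / 4.5 / PROP 4.6 (p0018 L37–64, proof p0018 L78–p0019 L12): `Φ_μ` the CM type of `μ`, `M'_μ ⊆ ℂ` the reflex
field of `(E,Φ_μ)`, `M_μ ⊇ M'_μ` the field of values of `μ^{alg}`; `A_μ` an abelian variety over `E` with
`i_μ : M_μ → End_E(A_μ)_ℚ` such that "the determinant of the action of `i_μ(x)` on the `E`-vector space `Lie_E(A_μ)` equals
`N'_μ(x)`" (the reflex norm); existence via [Shi71] Thm 6 from `(A',i')` of the reflex type `(M'_μ, Φ'_μ)` — so
`(A_μ ⊗_{E,τ'} ℂ, i_μ)` has CM by `M_μ` with the type INFLATED from the reflex type `Φ'_μ` of `M'_μ`.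

READING (the dictionary under which the Prop below is [Liu21]; each item is bookkeeping already recorded in GAPS.md, none is
a theorem of this package):
* R1 (objects) `E = L`, `F = L₀`, `n = 3`, Compact Case (`[L₀:ℚ] ≥ 2`), `τ' = ι₁`; `P_Γ = U.pms L ι₁ V Γ` is a connected
  component of `X_{K_Γ} ⊗_{E,ι₁} ℂ` ([Liu21] Prop 9.5 / App. C, GAPS.md pv14-G1), so `H¹(P_Γ,ℂ) ⊆ H¹_{B,ι₁}(X_{K_Γ},ℂ) =
  H¹_{B,ι₁}(A_{K_Γ},ℂ)` (Lemma le:albanese) and a morphism `A_{K_Γ} → A_μ` composed with the Albanese map restricted to the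
  component is a `U.Mor (U.pms L ι₁ V Γ) (U.cmAV M Θ)`; PerL's neat levels `Γ` are Liu's "sufficiently small `K`" (both:
  the level acts freely, `X_K` smooth); for a level that is not, pass to a neat `Γ' ≤ Γ` and descend by the trace of
  morphisms to an abelian variety (`g_* f^* α = (tr_g f)^* α` for translation-invariant `α`).
* R2 (classes) PerL's theta one-forms of type `Ψᵢ` at level `Γ` (`T.Theta V c i Γ`, PerL §3.2 / Lemma 3.3(a): lifts of
  allowed pairs `(Wᵢ, χ'ᵢ)` of type `Ψᵢ`) are holomorphic classes in the `ω(μᵢ, ε(aᵢ), χ'ᵢ)`-isotypic part, allowed pair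
  ↔ adèlic oscillator triple (GAPS.md pv14-G1, `LiuAlbaneseDatum` header; kernel side N12 = `PerL34.AllowedA.N12_of`).
  Holomorphy lets one replace Liu's `α` by its `(1,0)`-component (pullbacks and the `M_μ`-action respect the Hodge
  decomposition), which lies in `U.alphaLine M Θ σ'`.
* R3 (types, SIGN-EXACT — CLOSED as PRINT-DERIVED, GAPS.md pv04g3-C1 / pv04g3-C3) `Φ_{μᵢ}` is the CM type
  `Φ(Ψᵢ) = {ι₁ ∘ g : ι₁ ∘ g⁻¹ ∘ j ∈ Ψᵢ}` of `L` (`j : K → L` the structure map, `σ = ι₁ ∘ j`; PerL's `Ψ_{tⁱ} = φ^h Φ̃_{tⁱ}⁻¹`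
  in the frame `φ^h = ι₁`), i.e. the type whose reflex, transported to `K` along `σ`, is `Ψᵢ = c.Ψ i` (GAPS.md pv01-G1c /
  pv14-G1 (iv); PerL Lemma 2.1 = kernel `ReflexWelldef`/A11).  Derivation (a): [Liu21] p0063 L36 "`μ̃_{τ₁}(z) = 1/z`, where we
  have identified `ℂ` with `E ⊗_{τ₁} ℝ` through the embedding `τ'₁`" (`τ'₁ ∈ Φ_μ`, Thm 10.6(1)), "which implies that
  `μ̃ = μ|·|_E^{−1/2}`" pins Def 4.2 as `μ_v(z) = (τ'z/|τ'z|)^{−1}` for `τ' ∈ Φ_μ` above `v`, which is PerL's defining display of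
  `Φ'(π)` (eq. Phiprime) literally, so `Φ_{μ(πᵢ)} = Φ'(πᵢ)` = PerL's `L`-type `Ψ_{tⁱ}` (Lemma 3.3(a)) `= Φ(Ψᵢ)` for the
  package's `K`-type `Ψᵢ = c.Ψ i` = PerL's `tⁱ ∋ φ₁ = σ` (Lemma 2.1(b): `Ψ_{tⁱ} = φ^h Φ̃_{tⁱ}⁻¹`, `Ψ_{tⁱ}^* = Φ_{tⁱ}`), with
  `μ(πᵢ) = μᵢ` (GAPS.md pv01-G1d).  Derivation (b),
  glyph-free — its two inferences are KERNEL since gen 7 (`HodgeCM/CM/TypeOfDet.lean`, GAPS.md pv04g7-K1; before: by hand,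
  GAPS.md pv04g3-C3 (2)–(3)): Def 4.5(1) (p0018 L67, "the determinant of the action of `i_μ(x)` on the `E`-vector space
  `Lie_E(A_μ)` equals `N_μ(x)`"), read on the eigenline decomposition `Lie_E(A_μ) ⊗_{E,ι₁} ℂ = ⊕_{θ∈Θ} ℂ_θ` (p0023 L1) with
  `ι₁ ∘ N'_μ = ∏_{σ'∈Φ'_μ} σ'` (Def 4.3, the reflex norm), says `∏_{θ∈Θ} θ(x) = ∏_{σ'∈Φ'_μ} σ'(N_{M_μ/M'_μ} x)` for all `x ∈ M_μ`,
  and `CMTypeOps.type_eq_inflate_of_det` (multiplicative independence of embeddings, `CMTypeOps.finset_eq_of_prod_apply_eq`)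
  returns `Θ = {θ : θ|_{M'_μ} ∈ Φ'_μ}` = the inflation of the reflex type `Φ'_μ` — the type, not its conjugate; and for
  `Φ_μ = Φ(Ψ)` the reflex type inflated to `K` along `j` is `Ψ` itself, not `Ψ̄`: `CMTypeOps.comp_mem_iff_mem_doubleReflex`
  (`ι₁ ∘ g ∘ j ∈ Ψ ↔ g ∈ Ψ̃·Stab` with `Ψ̃ := {h : ι₁hj ∈ Ψ} = aSet (aSet (pullType ι₁ Ψ) j) 1` and `Stab` the stabiliser of
  `aSet (pullType ι₁ Ψ) j`, whose `ι₁`-image is `Φ(Ψ)` by `CMTypeOps.reflexInflateSet_eq`; `CMTypeOps.doubleReflex_pullType_eq`),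
  the transitivity of `Aut L` on `Hom(K, L)` used by `ReflexWelldef` being `CMTypeOps.isPretransitive_autHom`; holomorphy of
  the theta forms at `ι₁` fixes the frame (`GoodCtx.mem/forced`: `σ ∈ Ψᵢ` for all `i`, i.e. `ι₁ ∈ Φ(Ψᵢ)`).
* R4 (the CM variety) `M := M_{μᵢ}·σ(K)`, the compositum in `ℂ` (a CM field: `M_{μᵢ}` is CM, being generated over the CM
  field `M'_{μᵢ}` by values of an algebraic Hecke character of nonzero weight, and a compositum of CM fields is CM),
  `k : K →+* M := σ` (the reflex field `M'_{μᵢ}` of `(L,Φ_{μᵢ})` lies IN `σ(K)` — kernel, `CMTypeOps.stabilizer_le_stabilizer_reflexSet`;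
  it EQUALS `σ(K)`, and then `M = M_{μᵢ}` and `k = (M'_{μᵢ} ⊆ M_{μᵢ}) ∘ (σ : K ≅ M'_{μᵢ})`, iff `Ψᵢ` is primitive — PerL
  Lemma 2.1(b) `L^*_{Ψ_t} = K` for PerL's sextic `K`, all of whose types are primitive ([Y1neg] Lemma 7.1, tex l. 48), KERNEL in
  the binders of `U.PerL` as `PerL34.GaloisB3.perL_rightStab_tilde_eq_H` (pv01, `GaloisB3CM.lean`) with
  `PerL34.ReflexWelldef.rightStab_iff`; `GoodCtx` alone does not give it), `σ'` := the inclusion `M ⊂ ℂ`, so `σ' ∘ k = σ`; `Θ := inflate k (c.Ψ i)` is the inflation to `M` of the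
  type `Θ_{μᵢ}` of `(A_{μᵢ} ⊗_{ι₁} ℂ, i_{μᵢ})` (Def 4.5(1) + R3 (b): both are the inflation of `Φ'_{μᵢ}`), so the model's reference
  variety `U.cmAV M Θ` is `M`-isogenous to `(A_{μᵢ} ⊗_{ι₁} ℂ)^{[M:M_{μᵢ}]} = A_{μᵢ} ⊗_{M_{μᵢ}} M` (Shimura 1998 §6.2 Thm 3, as in
  M38, and §6.1 Thm 2 Cor., as in M25); a pullback `F^*α` from `A_{μᵢ} ⊗ ℂ` is `c_r⁻¹ (ι_r ∘ F)^*β` for the `σ'`-eigen form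
  `β = Σ_s c_s pr_s^*α` of the power and a factor inclusion `ι_r` with `c_r ≠ 0` (`pr_s ∘ ι_r` is the identity for `s = r` and zero otherwise), and an
  isogeny does not change the set of pullbacks `F^*α`.
CAVEAT carried over (GAPS.md cfKHR-A1): [Liu21] Thm 4.18 itself rests on the endoscopic classification for `U(n)`
(Prop 4.13's proof: [MR92] Lemma 1, Props pr:endoscopy_general, th:cm_albanese_pre) — published, but deep. -/
def Fact_thetaAlbanese : Prop :=
  ∀ {L : CMField} {ι₁ : L →+* ℂ} (V : HermSpace3 L ι₁) (c : SeesawCtx L), T.GoodCtx ι₁ c →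
    ∀ (i : Fin 4) (Γ : Level V), ∃ (M : CMField) (k : c.K →+* M) (σ' : M →+* ℂ), σ'.comp k = c.σ ∧
      T.Theta V c i Γ ⊆ U.Uiso Γ M (inflate k (c.Ψ i)) σ'

/-- **Seam S6 / node N12a reached BY NAME: `Open_thetaSub` from M2 `Fact_pull_comp`, M13 `Fact_alphaLine`, M38
`Fact_cmInflation` (Shimura 1998 §6 Thm 3) and the [Liu21] interface fact `Fact_thetaAlbanese`.**  Proof: the theta forms
lie in `U_{(M, Ψᵢ^M, σ')}(Γ)` (Liu), which is contained in `U_{(K, Ψᵢ, σ'∘k)}(Γ) = U_{Ψᵢ}(Γ)` (`Uiso_inflate_le`). -/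
theorem open_thetaSub_of_liu (h2 : U.Fact_pull_comp) (h13 : U.Fact_alphaLine) (h31 : U.Fact_cmInflation)
    (hLiu : T.Fact_thetaAlbanese) : T.Open_thetaSub := by
  intro L ι₁ V c hc i Γ ω hω
  obtain ⟨M, k, σ', hσ, hsub⟩ := hLiu V c hc i Γ
  have h := U.Uiso_inflate_le h2 h13 h31 Γ c.K M k (c.Ψ i) σ' (hsub hω)
  rw [hσ] at h
  exact h

/-- CONTRIBUTING §3 L2 shape (`X_of_split (M : U.ModelAxioms) : X₁ → … → X`): the two pieces of the split of
`Open_thetaSub` are M38 `U.Fact_cmInflation` (PRINT model fact, L3 candidate) and `T.Fact_thetaAlbanese` (PRINT-interface,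
carries the difficulty = the [Liu21] reading R1–R4); M2 and M13 come from the record. -/
theorem open_thetaSub_of_split (M : U.ModelAxioms) : U.Fact_cmInflation → T.Fact_thetaAlbanese → T.Open_thetaSub :=
  T.open_thetaSub_of_liu M.pull_comp M.alphaLine

/-- The carver's alias form: `PerL34.N12a_thetaSub T` (= `Open_thetaSub` by `rfl`) from the same four inputs. -/
theorem N12a_of_liu (h2 : U.Fact_pull_comp) (h13 : U.Fact_alphaLine) (h31 : U.Fact_cmInflation)
    (hLiu : T.Fact_thetaAlbanese) :
    ∀ {L : CMField} {ι₁ : L →+* ℂ} (V : HermSpace3 L ι₁) (c : SeesawCtx L), T.GoodCtx ι₁ c →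
      ∀ (i : Fin 4) (Γ : Level V), T.Theta V c i Γ ⊆ U.Uiso Γ c.K (c.Ψ i) c.σ :=
  T.open_thetaSub_of_liu h2 h13 h31 hLiu

/-- Honest strength note: conversely `Open_thetaSub` gives the interface fact with the trivial inflation `M = K`,
`k = id` — so the split isolates exactly the CM-inflation step (kernel + M38); it does not weaken the Liu reading
beyond that. -/
theorem fact_thetaAlbanese_of_open (h : T.Open_thetaSub) : T.Fact_thetaAlbanese := by
  intro L ι₁ V c hc i Γ
  refine ⟨c.K, RingHom.id _, c.σ, by simp, ?_⟩
  rw [CMTypeOps.inflate_id]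
  exact h V c hc i Γ

end ThetaModel

end Universe

end HodgeCM

end
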